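import Summits.SmoothPoincare4.SmoothPoincare4.Theses.InformationMetricHadamard
import Summits.SmoothPoincare4.SmoothPoincare4.Theorems.AhHadamardFilling.Negative.HyperbolicConeCollar
import Summits.SmoothPoincare4.SmoothPoincare4.Theorems.InformationMetricHadamardAhHadamardFillingStubHadamardLocallyConvexIsConvex
import Literature.Geometry.Riemannian.HyperboloidCartanHadamard
import Literature.Geometry.Riemannian.RoundSphere
import Literature.Geometry.Riemannian.GeodesicConvexity
import Literature.Geometry.Riemannian.HadamardExpCovering
import Mathlib.Geometry.Manifold.LocalDiffeomorph

/-!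
# `SmoothPoincare4 →` stub X (`TameFillingNoPi1`) of line `Sketch`: the open stub is EXACTLY the summit

Negative side of crux `InformationMetricHadamard.AhHadamardFilling` (item stmt-SmoothPoincare4-6014,
line `Sketch`, lead continuation c1). The line's only open stub X (`stub_tameFillingNoPi1`,
skeleton `Cruxes/AhHadamardFilling/Lines/Sketch.lean`) asks, for every homotopy 4-sphere `S`, for a
complete CONNECTED `sec ≤ 0` filling with a proper smooth injective IMMERSIVE cone collar, one far
complement of which has nonempty interior and is `δ`-locally `d`-convex in the betweenness form.
`Theorems/InformationMetricHadamardAhHadamardFillingReduction.lean` proves `X → SmoothPoincare4`;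
this file proves the converse **`SmoothPoincare4 → X`** with the hyperbolic witness of
`OfSmoothPoincare4.lean` (`W = ℍ⁵` in the graph chart of the hyperboloid model, cone collar
`Φ(σ, λ) = λ⁻¹ f(σ)` over `S ≅ S⁴ ⊂ ℝ⁵`), supplying the two extra clauses:

* `coneCollar_mfderiv_injective` — the cone collar is immersive (`dΦ(v,s) = λ⁻¹ df v - (s/λ²) f`,
  and `df v ⟂ f`);
* `norm_le_of_between` — **Euclidean balls `{‖u‖ ≤ R}` of the graph chart are totally convex for
  the hyperbolic distance in the betweenness form**: a between-point `m` of `p, q`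
  (`d(p,m) + d(m,q) = d(p,q)`) lies on the minimizing geodesic `[p, q]`
  (`eq_maximalGeodesic_of_between`, Cartan–Hadamard uniqueness), along which `-‖·‖²` has no dip
  below a negative level (`GGSU.le_comp_geodesic_of_endpoints`) because its Riemannian Hessian is
  negative definite: `Hess(-‖·‖²)_x(u,u) = -2‖u‖² - 2 G_x(u,u) ‖x‖²` (chart Hessian
  `OpensChart.hessian_eq` with the Christoffel symbols `Γ_x(u,u) = -G_x(u,u) x` of
  `Hyperboloid.christoffel_eq`) — `hessian_negNormSq_neg`.

Main results: `tameFillingNoPi1_of_smoothPoincare4 : SmoothPoincare4 → ∀ S, X S` and the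
contrapositive reading: refuting stub X is disproving SPC4.
-/

noncomputable section

open Bundle Set TopologicalSpace Function Metric Module
open scoped Manifold ContDiff Topology RealInnerProductSpace NNReal

namespace Summit.SmoothPoincare4.SmoothPoincare4.Theorems.AhHadamardFilling.Negative

open Literature.Geometry.Riemannian Literature.Geometry.Riemannian.Hyperboloid
open Literature.Geometry.Lorentzian Literature.Geometry.Lorentzian.PseudoRiemannianMetric
open Literature.Topology.FourManifolds (HomotopySphere)
open Summit.SmoothPoincare4.SmoothPoincare4.Cruxes.AhHadamardFilling.Sketch

-- the prescribed namespace `Summit.<P>.<Sub>.…` duplicates `SmoothPoincare4` (P = Sub)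
set_option linter.dupNamespace false
-- instance search through the nested operator type `ℝ⁵ →L[ℝ] ℝ⁵ →L[ℝ] ℝ` of the metric components
set_option maxSynthPendingDepth 3

/-! ### The Hessian of `-‖·‖²` for the hyperbolic metric is negative definite -/

section Hessian

variable {V : Type*} [NormedAddCommGroup V] [InnerProductSpace ℝ V]

/-- `d(-‖·‖²)_z = -2⟪z, ·⟫`. [folklore] -/
theorem hasFDerivAt_negNormSq (z : V) :
    HasFDerivAt (fun z : V ↦ -‖z‖ ^ 2) (-(2 • (innerSL ℝ z : V →L[ℝ] ℝ))) z :=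
  (hasStrictFDerivAt_norm_sq z).hasFDerivAt.neg

/-- `D(-‖·‖²) = -2 innerSL` as a map `V → V →L ℝ`. [folklore] -/
theorem fderiv_negNormSq :
    fderiv ℝ (fun z : V ↦ -‖z‖ ^ 2) = fun z ↦ (-(2 • (innerSL ℝ : V →L[ℝ] V →L[ℝ] ℝ))) z := by
  funext z
  rw [(hasFDerivAt_negNormSq z).fderiv]
  rfl

/-- `-‖·‖²` is smooth. [folklore] -/
theorem contDiff_negNormSq : ContDiff ℝ ∞ (fun z : V ↦ -‖z‖ ^ 2) :=
  (contDiff_norm_sq ℝ).neg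

variable [FiniteDimensional ℝ V]

/-- **`Hess(-‖·‖²)_x(u, u) = -2‖u‖² - 2 G_x(u,u) ‖x‖²`** for the hyperbolic metric
`Hyperboloid.metric ⊤` (chart Hessian `D²Φ(u,u) - DΦ(Γ(u,u))`, O'Neill 1983, Lemma 3.49, with
`Γ_x(u,u) = -G_x(u,u) x`). [folklore] -/
theorem hessian_negNormSq_eq [(metric (⊤ : Opens V)).HasLeviCivita] (x : (⊤ : Opens V))
    (u : TangentSpace 𝓘(ℝ, V) x) :
    (metric (⊤ : Opens V)).hessian (fun y : (⊤ : Opens V) ↦ -‖(y : V)‖ ^ 2) x u u =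
      -2 * ‖(id u : V)‖ ^ 2 - 2 * comp (x : V) u u * ‖(x : V)‖ ^ 2 := by
  haveI : Fact ((1 : ℕ∞ω) ≤ (∞ : ℕ∞ω)) := ⟨by exact_mod_cast le_top⟩
  have h2 : (2 : ℕ∞ω) ≤ ∞ := WithTop.coe_le_coe.mpr le_top
  have hΦ : ContDiffAt ℝ 2 (fun z : V ↦ -‖z‖ ^ 2) (x : V) := (contDiff_negNormSq.of_le h2).contDiffAt
  rw [OpensChart.hessian_eq (g := metric (⊤ : Opens V)) (G := comp) (fun _ ↦ rfl) x
    (contDiff_comp.contDiffAt.differentiableAt (by simp)) (fun _ ↦ rfl) hΦ]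
  change OpensChart.hessianForm (metric (⊤ : Opens V)) comp (fun z : V ↦ -‖z‖ ^ 2) x u u = _
  rw [OpensChart.hessianForm_apply, christoffel_eq, fderiv_negNormSq, ContinuousLinearMap.fderiv]
  simp only [neg_apply, FunLike.coe_smul, Pi.smul_apply, innerSL_apply_apply, map_smul,
    smul_eq_mul, nsmul_eq_mul, Nat.cast_ofNat]
  change -(2 * ((innerSL ℝ : V →L[ℝ] V →L[ℝ] ℝ) (id u : V) (id u : V))) -
      -(comp (x : V) u u) * -(2 * ⟪(x : V), (x : V)⟫) = _
  rw [innerSL_apply_apply, real_inner_self_eq_norm_sq, real_inner_self_eq_norm_sq]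
  ring

/-- **The Hessian of `-‖·‖²` is negative definite** for the hyperbolic metric: `< 0` on `u ≠ 0`.
[folklore] -/
theorem hessian_negNormSq_neg [(metric (⊤ : Opens V)).HasLeviCivita] (x : (⊤ : Opens V))
    {u : TangentSpace 𝓘(ℝ, V) x} (hu : u ≠ 0) :
    (metric (⊤ : Opens V)).hessian (fun y : (⊤ : Opens V) ↦ -‖(y : V)‖ ^ 2) x u u < 0 := by
  rw [hessian_negNormSq_eq]
  have h1 : 0 < ‖(id u : V)‖ ^ 2 := by
    have : (id u : V) ≠ 0 := hu
    positivity
  have h2 : 0 ≤ comp (x : V) u u * ‖(x : V)‖ ^ 2 :=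
    mul_nonneg (comp_pos (x : V) hu).le (sq_nonneg _)
  linarith

omit [FiniteDimensional ℝ V] in
/-- `d(-‖·‖²)_x ≠ 0` at `x ≠ 0` on the open submanifold (its value on `x` is `-2‖x‖²`).
[folklore] -/
theorem mvfderiv_negNormSq_ne_zero (x : (⊤ : Opens V)) (hx : (x : V) ≠ 0) :
    mvfderiv 𝓘(ℝ, V) (fun y : (⊤ : Opens V) ↦ -‖(y : V)‖ ^ 2) x ≠ 0 := by
  intro h
  have h1 := OpensChart.mvfderiv_eq x (fun y : (⊤ : Opens V) ↦ -‖(y : V)‖ ^ 2)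
    (fun z : V ↦ -‖z‖ ^ 2) (fun _ ↦ rfl) (hasFDerivAt_negNormSq (x : V)).differentiableAt
    (show TangentSpace 𝓘(ℝ, V) x from (x : V))
  rw [h, (hasFDerivAt_negNormSq (x : V)).fderiv] at h1
  simp only [zero_apply, neg_apply, FunLike.coe_smul, Pi.smul_apply, innerSL_apply_apply,
    real_inner_self_eq_norm_sq, nsmul_eq_mul, Nat.cast_ofNat] at h1
  have : 0 < ‖(x : V)‖ ^ 2 := by positivity
  linarith

end Hessian

/-! ### Euclidean balls of the graph chart are totally convex for the hyperbolic distance -/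

section Convex

/-- **No between-point leaves the ball.** In `ℍ⁵` (graph chart of the hyperboloid model,
`Hyperboloid.metric ⊤` on `⊤ : Opens ℝ⁵`), if `‖p‖, ‖q‖ ≤ R` and `m` is a between-point of `p, q`
for the Riemannian distance, `d(p, m) + d(m, q) = d(p, q)`, then `‖m‖ ≤ R`: `m` lies on the
minimizing geodesic `[p, q]` (`eq_maximalGeodesic_of_between`, geodesics from a point of a
Cartan–Hadamard manifold are injective, `expMap_injective`), and `-‖·‖²` does not dip below
`-R²` along a geodesic (`GGSU.le_comp_geodesic_of_endpoints`, negative definite Hessian).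
[folklore] -/
theorem norm_le_of_between {R : ℝ} (hR : 0 < R)
    {p q m : (⊤ : Opens (EuclideanSpace ℝ (Fin 5)))}
    (hp : ‖(p : EuclideanSpace ℝ (Fin 5))‖ ≤ R) (hq : ‖(q : EuclideanSpace ℝ (Fin 5))‖ ≤ R)
    (hm : (metric ⊤).edist isRiemannian_metric p m + (metric ⊤).edist isRiemannian_metric m q =
      (metric ⊤).edist isRiemannian_metric p q) :
    ‖(m : EuclideanSpace ℝ (Fin 5))‖ ≤ R := by
  set G := metric (⊤ : Opens (EuclideanSpace ℝ (Fin 5))) with hGdef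
  have hG : G.IsRiemannian := isRiemannian_metric
  -- instances and standing facts (as in the line's A1 file)
  haveI : LocallyCompactSpace (⊤ : Opens (EuclideanSpace ℝ (Fin 5))) :=
    Manifold.locallyCompact_of_finiteDimensional (I := 𝓡 5)
  haveI hLC : G.HasLeviCivita := G.hasLeviCivita
  have hk1 : ((1 : ℕ∞) : ℕ∞ω) + 1 ≤ (∞ : ℕ∞ω) := by
    rw [show ((1 : ℕ∞) : ℕ∞ω) + 1 = 2 by norm_num]; exact WithTop.coe_le_coe.2 le_top
  haveI : CovariantDerivative.ContMDiffCovariantDerivative G.leviCivita 1 :=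
    ⟨G.isLocallyContMDiff_leviCivita_holds 1 hk1 univ isOpen_univ⟩
  haveI : CovariantDerivative.ContMDiffCovariantDerivative G.leviCivita ∞ :=
    ⟨G.isLocallyContMDiff_leviCivita_holds ⊤ (le_of_eq rfl) univ isOpen_univ⟩
  haveI : Fact ((1 : ℕ∞ω) ≤ (∞ : ℕ∞ω)) := ⟨by exact_mod_cast le_top⟩
  haveI := connectedSpace_top (V := EuclideanSpace ℝ (Fin 5))
  haveI := simplyConnectedSpace_top (V := EuclideanSpace ℝ (Fin 5))
  have hc : IsGeodesicallyComplete G.leviCivita := isGeodesicallyComplete_metric_top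
  have hsec' : ∀ (x : (⊤ : Opens (EuclideanSpace ℝ (Fin 5)))) (U W : TangentSpace (𝓡 5) x),
      G.curvatureForm G.leviCivita x U W W U ≤ 0 :=
    HadamardExpCovering.curvatureForm_leviCivita_nonpos_of_sectionalCurvature_nonpos G hG
      (fun cov hcov x X Y ↦ sectionalCurvature_nonpos ⊤ cov hcov x X Y)
  have hinj := expMap_injective hG hc hsec'
  set D : (⊤ : Opens (EuclideanSpace ℝ (Fin 5))) → (⊤ : Opens (EuclideanSpace ℝ (Fin 5))) → ℝ :=
    fun a b ↦ (G.edist hG a b).toReal with hDdef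
  have hD : ∀ a b, D a b = (G.edist hG a b).toReal := fun _ _ ↦ rfl
  -- the between relation in real form
  have hm' : D p m + D m q = D p q := by
    rw [hD, hD, hD, ← ENNReal.toReal_add (edist_ne_top hG p m) (edist_ne_top hG m q), hm]
  have hmq0 : 0 ≤ D m q := (rdist_basic hG hD m q).1
  have hpm0 : 0 ≤ D p m := (rdist_basic hG hD p m).1
  -- the convex function `φ = -‖·‖²` and its no-dip property below `0`
  set φ : (⊤ : Opens (EuclideanSpace ℝ (Fin 5))) → ℝ := fun y ↦ -‖(y : EuclideanSpace ℝ (Fin 5))‖ ^ 2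
    with hφdef
  have hφ : ContMDiff (𝓡 5) 𝓘(ℝ, ℝ) ∞ φ := by
    intro y
    exact (contMDiffAt_subtype_iff (U := (⊤ : Opens (EuclideanSpace ℝ (Fin 5))))
      (f := fun z : EuclideanSpace ℝ (Fin 5) ↦ -‖z‖ ^ 2)).2 contDiff_negNormSq.contMDiff.contMDiffAt
  have hcvx : ∀ x : (⊤ : Opens (EuclideanSpace ℝ (Fin 5))), φ x < 0 →
      mvfderiv (𝓡 5) φ x ≠ 0 ∧ ∀ u : TangentSpace (𝓡 5) x, u ≠ 0 → mvfderiv (𝓡 5) φ x u = 0 →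
        G.hessian φ x u u < 0 := by
    intro x hx
    have hx0 : (x : EuclideanSpace ℝ (Fin 5)) ≠ 0 := by
      intro h0; rw [hφdef] at hx; simp only [h0, norm_zero] at hx; norm_num at hx
    exact ⟨mvfderiv_negNormSq_ne_zero x hx0, fun u hu _ ↦ hessian_negNormSq_neg x hu⟩
  have hφR : ∀ y : (⊤ : Opens (EuclideanSpace ℝ (Fin 5))),
      -R ^ 2 ≤ φ y ↔ ‖(y : EuclideanSpace ℝ (Fin 5))‖ ≤ R := by
    intro y
    rw [hφdef, neg_le_neg_iff]
    exact pow_le_pow_iff_left₀ (norm_nonneg _) hR.le two_ne_zero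
  -- the degenerate case `p = q`
  by_cases hpq : p = q
  · subst hpq
    have hpp : D p p = 0 := (rdist_basic hG hD p p).2.1
    have h0 : D p m = 0 := by linarith
    rw [← eq_of_rdist_eq_zero hG hD h0]
    exact hp
  -- `m` lies on the minimizing geodesic `γ` from `p` to `q`
  obtain ⟨u, hu, hγq⟩ := exists_unit_maximalGeodesic_eq hG hc hD hpq
  have hmγ : m = maximalGeodesic G.leviCivita p u (D p m) :=
    eq_maximalGeodesic_of_between hG hc hD hinj hu hγq hm'
  obtain ⟨-, hgeo, hγ0, hγv⟩ := maximalGeodesic_of_isGeodesicallyComplete hc p u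
  have hu0 : u ≠ 0 := by
    rintro rfl
    simp at hu
  have hv : velocity (𝓡 5) (maximalGeodesic G.leviCivita p u) 0 ≠ 0 := by
    rw [hγv]; exact hu0
  have hneg : -R ^ 2 < 0 := by nlinarith
  have key := GGSU.le_comp_geodesic_of_endpoints (g := G) hG hφ hcvx hgeo hv (a := 0) (b := D p q)
    hneg ((hφR _).2 (by rw [hγ0]; exact hp)) ((hφR _).2 (by rw [hγq]; exact hq)) (D p m)
    ⟨hpm0, by linarith⟩
  rw [hmγ]
  exact (hφR _).1 key

end Convex


/-! ### The cone collar is immersive -/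

section Immersive

variable {N : Type} [TopologicalSpace N] [ChartedSpace (EuclideanSpace ℝ (Fin 4)) N]
  [IsManifold (𝓡 4) ∞ N] (f : N → EuclideanSpace ℝ (Fin 5))

/-- **The cone collar `Φ(x, λ) = λ⁻¹ f(x)` is immersive** on `λ ≠ 0` when `f` is an immersion into
the unit sphere: `dΦ(v, s) = λ⁻¹ df v - (s/λ²) f = 0` forces `s = 0` (pair with `f ⟂ df v`) and then
`df v = 0`. [folklore] -/
theorem coneCollar_mfderiv_injective (hf : ContMDiff (𝓡 4) (𝓡 5) ∞ f) (h1 : ∀ x, ‖f x‖ = 1)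
    (himm : ∀ x, Injective (mfderiv (𝓡 4) (𝓡 5) f x)) (x : N) {l : ℝ} (hl : l ≠ 0) :
    Injective (mfderiv ((𝓡 4).prod 𝓘(ℝ, ℝ)) (𝓡 5)
      (fun p : N × ℝ ↦ (⟨(p.2)⁻¹ • f p.1, trivial⟩ : (⊤ : Opens (EuclideanSpace ℝ (Fin 5))))) (x, l)) := by
  refine (injective_iff_map_eq_zero _).2 fun w hw ↦ ?_
  obtain ⟨v, s⟩ := w
  rw [mfderiv_coneCollar_apply f hf x hl v s] at hw
  -- pair with `f x`: `s = 0`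
  have hfx : ⟪f x, f x⟫ = 1 := by rw [real_inner_self_eq_norm_sq, h1 x, one_pow]
  have horth : ⟪f x, (id (mfderiv (𝓡 4) (𝓡 5) f x v) : EuclideanSpace ℝ (Fin 5))⟫ = 0 :=
    inner_mfderiv_eq_zero_of_norm_eq_one f hf h1 x v
  have h0 : ⟪f x, l⁻¹ • (id (mfderiv (𝓡 4) (𝓡 5) f x v) : EuclideanSpace ℝ (Fin 5)) +
      (-(s * (l ^ 2)⁻¹)) • f x⟫ = 0 := by
    rw [hw]
    show ⟪f x, (0 : EuclideanSpace ℝ (Fin 5))⟫ = 0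
    exact inner_zero_right _
  rw [inner_add_right, inner_smul_right, inner_smul_right, horth, hfx, mul_zero, zero_add, mul_one,
    neg_eq_zero, mul_eq_zero, inv_eq_zero] at h0
  have hs : s = 0 := h0.resolve_right (pow_ne_zero 2 hl)
  subst hs
  -- then `df v = 0`, so `v = 0`
  simp only [zero_mul, neg_zero, zero_smul, add_zero] at hw
  rcases smul_eq_zero.1 hw with h | h
  · exact absurd (inv_eq_zero.1 h) hl
  have hv : v = 0 := himm x (by
    change (id (mfderiv (𝓡 4) (𝓡 5) f x v) : EuclideanSpace ℝ (Fin 5)) = mfderiv (𝓡 4) (𝓡 5) f x 0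
    rw [h]
    exact ((mfderiv (𝓡 4) (𝓡 5) f x).map_zero).symm)
  subst hv
  rfl

end Immersive

/-! ### `SmoothPoincare4 →` stub X -/

/-- **`SmoothPoincare4 → TameFillingNoPi1`**: the summit implies the open stub X of line `Sketch`
(every clause of `stub_tameFillingNoPi1`, for every homotopy 4-sphere), by the hyperbolic witness:
`W = ℍ⁵` (`⊤ : Opens ℝ⁵`, `Hyperboloid.metric ⊤`: connected, complete, `sec ≤ 0`), `g = f^*⟪·,·⟫`
for `f = ι ∘ d`, `d : S ≅ S⁴` from SPC4, `c = 1`, the cone collar (smooth, injective, immersive,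
far parts `{‖u‖ > 1/t}`), the far complement `K_{1/2} = {‖u‖ ≤ 2}` (interior `∋ 0`, totally convex
by `norm_le_of_between`, so `δ = 1` works), and the `C⁰` cone asymptotics of
`coneCollar_asymptotics`. Hence (with `smoothPoincare4_of_tameFillingNoPi1` of the Reduction file)
**X ↔ SmoothPoincare4**: the open stub of the line is exactly the summit.
[cite: Lee2018, Thm. 3.7 and Example 12.10] -/
theorem tameFillingNoPi1_of_smoothPoincare4 (hSPC4 : _root_.SmoothPoincare4) (S : HomotopySphere 4) :
    ∃ (g : PseudoRiemannianMetric (𝓡 4) ∞ (EuclideanSpace ℝ (Fin 4)) (TangentSpace (𝓡 4) : S.carrier → Type _))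
      (_ : g.IsRiemannian) (W : Type) (_ : TopologicalSpace W) (_ : T2Space W)
      (_ : SecondCountableTopology W) (_ : ChartedSpace (EuclideanSpace ℝ (Fin 5)) W) (_ : IsManifold (𝓡 5) ∞ W)
      (_ : ConnectedSpace W)
      (G : PseudoRiemannianMetric (𝓡 5) ∞ (EuclideanSpace ℝ (Fin 5)) (TangentSpace (𝓡 5) : W → Type _))
      (hG : G.IsRiemannian) (c : ℝ) (Φ : S.carrier × ℝ → W),
      0 < c ∧
      (∀ (x : W) (r : NNReal), IsCompact {y : W | G.edist hG x y ≤ r}) ∧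
      (∀ cov, G.IsLeviCivita cov →
        ∀ (x : W) (X Y : TangentSpace (𝓡 5) x), G.sectionalCurvature cov x X Y ≤ 0) ∧
      ContMDiffOn ((𝓡 4).prod 𝓘(ℝ, ℝ)) (𝓡 5) ∞ Φ (univ ×ˢ Ioo (0 : ℝ) 1) ∧
      InjOn Φ (univ ×ˢ Ioo (0 : ℝ) 1) ∧
      (∀ p ∈ univ ×ˢ Ioo (0 : ℝ) 1,
        Function.Injective (mfderiv ((𝓡 4).prod 𝓘(ℝ, ℝ)) (𝓡 5) Φ p)) ∧
      (∀ t ∈ Ioo (0 : ℝ) 1, IsCompact (Φ '' (univ ×ˢ Ioo (0 : ℝ) t))ᶜ) ∧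
      (∀ t ∈ Ioo (0 : ℝ) 1,
        closure (Φ '' (univ ×ˢ Ioo (0 : ℝ) t)) ⊆ Φ '' (univ ×ˢ Ioo (0 : ℝ) 1)) ∧
      (∃ t ∈ Ioo (0 : ℝ) 1, ∃ δ : ℝ, 0 < δ ∧
        (interior (Φ '' (univ ×ˢ Ioo (0 : ℝ) t))ᶜ).Nonempty ∧
        ∀ p ∈ (Φ '' (univ ×ˢ Ioo (0 : ℝ) t))ᶜ, ∀ q ∈ (Φ '' (univ ×ˢ Ioo (0 : ℝ) t))ᶜ,
          G.edist hG p q < ENNReal.ofReal δ →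
          ∀ m : W, G.edist hG p m + G.edist hG m q = G.edist hG p q →
            m ∈ (Φ '' (univ ×ˢ Ioo (0 : ℝ) t))ᶜ) ∧
      (∀ ε : ℝ, 0 < ε → ∃ t ∈ Ioo (0 : ℝ) 1, ∀ (x : S.carrier) (l : ℝ), l ∈ Ioo (0 : ℝ) t →
        ∀ (v : TangentSpace (𝓡 4) x) (s : ℝ),
          |G.val (Φ (x, l)) (mfderiv ((𝓡 4).prod 𝓘(ℝ, ℝ)) (𝓡 5) Φ (x, l) (v, s))
              (mfderiv ((𝓡 4).prod 𝓘(ℝ, ℝ)) (𝓡 5) Φ (x, l) (v, s)) -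
            c * (s ^ 2 + g.val x v v) / l ^ 2| ≤ ε * (c * (s ^ 2 + g.val x v v) / l ^ 2)) := by
  obtain ⟨e⟩ := S.nonempty_homotopyEquiv
  obtain ⟨d⟩ := hSPC4 S.carrier S.chartedSpace S.isManifold e
  -- the immersion `f = ι ∘ d : S → ℝ⁵` onto the unit sphere (as in `OfSmoothPoincare4.lean`)
  haveI : Fact (finrank ℝ (EuclideanSpace ℝ (Fin (4 + 1))) = 4 + 1) :=
    Fact.mk (@finrank_euclideanSpace_fin ℝ _ (4 + 1))
  set f : S.carrier → (EuclideanSpace ℝ (Fin 5)) :=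
    (Subtype.val : sphere (0 : EuclideanSpace ℝ (Fin (4 + 1))) 1 → EuclideanSpace ℝ (Fin (4 + 1))) ∘ d
    with hfdef
  have h1 : ∀ x, ‖f x‖ = 1 := fun x ↦ by simp [hfdef]
  have hinj : Injective f := Subtype.val_injective.comp d.injective
  have hsurj : ∀ y : (EuclideanSpace ℝ (Fin 5)), ‖y‖ = 1 → y ∈ range f := fun y hy ↦
    ⟨d.symm ⟨y, by simpa using hy⟩, by simp [hfdef]⟩
  have hfm : ∀ m : ℕ∞ω, m ≤ ∞ → ContMDiff (𝓡 4) (𝓡 5) m f := fun m hm ↦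
    (contMDiff_coe_sphere (E := EuclideanSpace ℝ (Fin (4 + 1))) (n := 4)).comp
      (d.contMDiff.of_le hm)
  have hf : ContMDiff (𝓡 4) (𝓡 5) ∞ f := hfm ∞ le_rfl
  have himm : ∀ x, Injective (mfderiv (𝓡 4) (𝓡 5) f x) := by
    intro x
    have hn : (∞ : ℕ∞ω) ≠ 0 := by simp
    have hd : MDifferentiableAt (𝓡 4) (𝓡 4) d x := d.contMDiffAt.mdifferentiableAt hn
    have hc : MDifferentiableAt (𝓡 4) (𝓡 5)
        (Subtype.val : sphere (0 : EuclideanSpace ℝ (Fin (4 + 1))) 1 → EuclideanSpace ℝ (Fin (4 + 1)))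
        (d x) :=
      (contMDiff_coe_sphere (E := EuclideanSpace ℝ (Fin (4 + 1))) (n := 4)).mdifferentiableAt hn
    rw [hfdef, mfderiv_comp x hc hd]
    exact (mfderiv_coe_sphere_injective (E := EuclideanSpace ℝ (Fin (4 + 1))) (n := 4) (d x)).comp
      (d.mfderivToContinuousLinearEquiv hn x).injective
  -- the induced metric `g = f^* ⟪·,·⟫` on `S`
  have hspace : (euclideanMetric (EuclideanSpace ℝ (Fin 5))).IsSpacelikeImmersion (𝓡 4) f := by
    refine ⟨hfm _ (le_of_eq rfl), fun y v hv ↦ ?_⟩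
    rw [inducedBilin_apply, euclideanMetric_apply]
    have hne : mfderiv (𝓡 4) (𝓡 5) f y v ≠ 0 := fun h0 ↦ hv (himm y (by rw [h0, map_zero]))
    exact real_inner_self_pos.mpr hne
  set g : PseudoRiemannianMetric (𝓡 4) ∞ (EuclideanSpace ℝ (Fin 4))
      (TangentSpace (𝓡 4) : S.carrier → Type _) :=
    (euclideanMetric (EuclideanSpace ℝ (Fin 5))).inducedMetric f contMDiff_pullbackBilin_holds hspace
    with hgdef
  have hgR : g.IsRiemannian := isRiemannian_inducedMetric _ _ contMDiff_pullbackBilin_holds hspace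
  have hgval : ∀ (x : S.carrier) (v : TangentSpace (𝓡 4) x),
      g.val x v v = ‖(id (mfderiv (𝓡 4) (𝓡 5) f x v) : (EuclideanSpace ℝ (Fin 5)))‖ ^ 2 := by
    intro x v
    rw [hgdef, inducedMetric_val, inducedBilin_apply, euclideanMetric_apply]
    exact real_inner_self_eq_norm_sq (id (mfderiv (𝓡 4) (𝓡 5) f x v) : (EuclideanSpace ℝ (Fin 5)))
  -- the witness
  haveI := connectedSpace_top (V := (EuclideanSpace ℝ (Fin 5)))
  refine ⟨g, hgR, (⊤ : Opens (EuclideanSpace ℝ (Fin 5))), inferInstance, inferInstance, inferInstance,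
    inferInstance, inferInstance, inferInstance, metric ⊤, isRiemannian_metric, 1,
    fun p : S.carrier × ℝ ↦ (⟨(p.2)⁻¹ • f p.1, trivial⟩ : (⊤ : Opens (EuclideanSpace ℝ (Fin 5)))),
    one_pos, isCompact_setOf_edist_le_top,
    fun cov hcov x X Y ↦ sectionalCurvature_nonpos ⊤ cov hcov x X Y,
    coneCollar_contMDiffOn f hf, coneCollar_injOn f hinj h1, ?_,
    fun t ht ↦ isCompact_compl_image_coneCollar f h1 hsurj ht,
    fun t ht ↦ closure_image_coneCollar_subset f h1 hsurj ht, ?_, ?_⟩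
  · -- immersivity
    rintro ⟨x, l⟩ hp
    exact coneCollar_mfderiv_injective f hf h1 himm x (ne_of_gt hp.2.1)
  · -- the far complement `K_{1/2} = {‖u‖ ≤ 2}`: nonempty interior, totally convex
    have ht : (1 / 2 : ℝ) ∈ Ioo (0 : ℝ) 1 := ⟨by norm_num, by norm_num⟩
    refine ⟨1 / 2, ht, 1, one_pos, ?_, ?_⟩
    · refine ⟨⟨0, trivial⟩, mem_interior_iff_mem_nhds.2 ?_⟩
      rw [image_coneCollar f h1 hsurj ht.1]
      have hopen : IsOpen {u : (⊤ : Opens (EuclideanSpace ℝ (Fin 5))) |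
          ‖(u : EuclideanSpace ℝ (Fin 5))‖ < (1 / 2 : ℝ)⁻¹} :=
        isOpen_lt (continuous_norm.comp continuous_subtype_val) continuous_const
      refine Filter.mem_of_superset (hopen.mem_nhds ?_)
        fun u (hu : ‖(u : EuclideanSpace ℝ (Fin 5))‖ < (1 / 2 : ℝ)⁻¹)
          (hu' : (1 / 2 : ℝ)⁻¹ < ‖(u : EuclideanSpace ℝ (Fin 5))‖) ↦ absurd (lt_trans hu' hu) (lt_irrefl _)
      show ‖((⟨0, trivial⟩ : (⊤ : Opens (EuclideanSpace ℝ (Fin 5)))) : EuclideanSpace ℝ (Fin 5))‖ <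
        (1 / 2 : ℝ)⁻¹
      simp
    · intro p hp q hq _ m hm
      rw [image_coneCollar f h1 hsurj ht.1] at hp hq ⊢
      simp only [mem_compl_iff, mem_setOf_eq, not_lt] at hp hq ⊢
      exact norm_le_of_between (by norm_num) hp hq hm
  · -- `C⁰` cone asymptotics
    intro ε hε
    obtain ⟨t, ht, H⟩ := coneCollar_asymptotics f hf h1 ε hε
    refine ⟨t, ht, fun x l hl v s ↦ ?_⟩
    rw [hgval x v]
    exact H x l hl v s

end Summit.SmoothPoincare4.SmoothPoincare4.Theorems.AhHadamardFilling.Negative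

end
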